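import Summits.PneNP.PneNP.Theorems.CliqueExtLowerBound.Negative.AnchoredThetaAnchor
import Literature.Computability.Complexity.MonotoneSwitching

/-!
# The children of the anchored theta gate and their values (anchored-theta refutation, part C2)

Part of the refutation of `stub_convReplaceable` (line `width-threshold-certificate-sparsity` of
crux stmt-PneNP-10682, `ConvexRankGates.CliqueExtLowerBound`) by the ANCHORED THETA GATE; the final
theorem is `stub_convReplaceable_false` in `ConvReplaceableFalse.lean`, whose module docstring has the
overview. Witness: at `c = 3`, for every `a`, localities `r = 3, s = 4`, at every large `m = n + 2`, the
theta programme on the `n+1` non-anchor vertices with clique parameter `k-1` (`k = ⌈m^{1/4}⌉₊`), fed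
with children `d_j = {{e₀, p_j}}`, `c_j = {{e₀, f(α,γ), f(β,γ)} : γ < h}`, is not replaceable by any
monotone circuit of size `m^a`: Jukna's criterion on the derived coordinates kills both exits.
-/

set_option linter.dupNamespace false

namespace Summit.PneNP.PneNP.Theorems.CliqueExtLowerBound.Negative

open Literature.Computability.Complexity Literature.Combinatorics.SimpleGraph Matrix Finset Filter

noncomputable section

section Children

variable (n : ℕ)

/-! ### The children -/

/-- The monomial `{e₀, p}` of the positive child at the pair `p`. -/
def mono (n : ℕ) (p : EP (n + 1)) : Finset (EV n) := {e0 n, embE n p}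

/-- POSITIVE CHILDREN `d_j = {{e₀, p_j}}` (one monomial of two edges). -/
def dd (n : ℕ) (j : Fin (nP (n + 1))) : Finset (Finset (EV n)) := {mono n (pr n j)}

/-- The clause of class `γ` at the pair `p`, as a set of unordered pairs: `{e₀} ∪ {f(α,γ) : α ∈ p}`. -/
def clauseS (n : ℕ) (p : EP (n + 1)) (γ : ℕ) : Finset (Sym2 (Fin (n + 2))) :=
  insert s(aA n, bB n) ((verts n p).image fun α => fS n α γ)

/-- The clause of class `γ` at the pair `p`, as a set of edge slots. -/
def clause (n : ℕ) (p : EP (n + 1)) (γ : ℕ) : Finset (EV n) :=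
  univ.filter fun e => (e : Sym2 (Fin (n + 2))) ∈ clauseS n p γ

/-- NEGATIVE CHILDREN `c_j = {{e₀, f(α,γ), f(β,γ)} : γ < h}` (`h` clauses of three edges). -/
def cc (n h : ℕ) (j : Fin (nP (n + 1))) : Finset (Finset (EV n)) :=
  (range h).image fun γ => clause n (pr n j) γ

/-- The positive monomial has at most two edges. -/
theorem card_mono_le (p : EP (n + 1)) : #(mono n p) ≤ 2 := card_insert_le _ _

/-- Each negative clause has at most three edges. -/
theorem card_clause_le (p : EP (n + 1)) (γ : ℕ) : #(clause n p γ) ≤ 3 := by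
  calc #(clause n p γ) ≤ #(clauseS n p γ) := by
        refine Finset.card_le_card_of_injOn (fun e : EV n => (e : Sym2 (Fin (n + 2)))) ?_ ?_
        · intro e he
          exact (mem_filter.1 (mem_coe.1 he)).2
        · intro e _ e' _ h
          exact Subtype.ext h
    _ ≤ #((verts n p).image fun α => fS n α γ) + 1 := card_insert_le _ _
    _ ≤ #(verts n p) + 1 := by gcongr; exact card_image_le
    _ = 3 := by rw [card_verts]

/-- The positive children are `3`-local (`(r-1)`-DNFs with `r = 3`). -/
theorem dd_local (j : Fin (nP (n + 1))) : ∀ R ∈ dd n j, #R ≤ 3 - 1 := by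
  intro R hR
  rw [dd, mem_singleton] at hR
  subst hR
  exact card_mono_le n _

/-- The negative children are `4`-local (`(s-1)`-CNFs with `s = 4`). -/
theorem cc_local (h : ℕ) (j : Fin (nP (n + 1))) : ∀ S ∈ cc n h j, #S ≤ 4 - 1 := by
  intro S hS
  obtain ⟨γ, -, rfl⟩ := mem_image.1 hS
  exact card_clause_le n _ γ

/-- Every negative clause contains the anchor edge. -/
theorem e0_mem_clause (p : EP (n + 1)) (γ : ℕ) : e0 n ∈ clause n p γ := by
  rw [clause, mem_filter]
  exact ⟨mem_univ _, by simp [clauseS]⟩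

/-- The positive child at `j` is on iff the anchor edge and the pair `p_j` are both present. -/
theorem evalDNF_dd_iff (j : Fin (nP (n + 1))) (x : EV n → Bool) :
    EvalDNF (dd n j) x ↔ x (e0 n) = true ∧ x (embE n (pr n j)) = true := by
  rw [dd, EvalDNF]
  simp only [mem_singleton, exists_eq_left, SatTerm, mono, mem_insert, forall_eq_or_imp, forall_eq]

/-- Consistency `d_j ≤ c_j`: every monomial and every clause contains the anchor edge. -/
theorem dd_le_cc (h : ℕ) (j : Fin (nP (n + 1))) (x : EV n → Bool) (hx : EvalDNF (dd n j) x) :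
    EvalCNF (cc n h j) x := by
  rw [evalDNF_dd_iff] at hx
  intro S hS
  obtain ⟨γ, -, rfl⟩ := mem_image.1 hS
  exact ⟨e0 n, e0_mem_clause n _ γ, hx.1⟩

/-- At most `(n+2)²` distinct child pairs. -/
theorem card_pairs_le (h : ℕ) :
    #((univ : Finset (Fin (nP (n + 1)))).image fun j => (dd n j, cc n h j)) ≤ (n + 2) ^ 2 := by
  calc #((univ : Finset (Fin (nP (n + 1)))).image fun j => (dd n j, cc n h j))
      ≤ #(univ : Finset (Fin (nP (n + 1)))) := card_image_le
    _ = nP (n + 1) := by simp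
    _ ≤ Fintype.card (Sym2 (Fin (n + 1))) :=
        Fintype.card_le_of_injective (fun e : EP (n + 1) => (e : Sym2 (Fin (n + 1)))) Subtype.val_injective
    _ ≤ Fintype.card (Fin (n + 1) × Fin (n + 1)) :=
        Fintype.card_le_of_surjective (Sym2.mk (α := Fin (n + 1))).uncurry Sym2.mk_surjective
    _ = (n + 1) ^ 2 := by simp [sq]
    _ ≤ (n + 2) ^ 2 := by gcongr; omega

/-! ### Values on the anchored positives -/

/-- The derived clique of an anchored `k`-set `K ∋ a₀`: its trace on the derived vertices. -/
def derS (n : ℕ) (K : Finset (Fin (n + 2))) : Finset (Fin (n + 1)) :=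
  univ.filter fun α => Fin.castSucc α ∈ K

/-- The derived trace of an anchored set, embedded back, is the set minus the anchor vertex. -/
theorem map_derS {K : Finset (Fin (n + 2))} :
    (derS n K).map Fin.castSuccEmb = K.erase (aA n) := by
  ext v
  rw [Finset.mem_map, mem_erase]
  constructor
  · rintro ⟨α, hα, rfl⟩
    rw [derS, mem_filter] at hα
    exact ⟨castSucc_ne_aA n α, hα.2⟩
  · rintro ⟨hne, hv⟩
    have hne' : v ≠ Fin.last (n + 1) := hne
    obtain ⟨α, rfl⟩ := Fin.exists_castSucc_eq.2 hne'
    refine ⟨α, ?_, rfl⟩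
    rw [derS, mem_filter]
    exact ⟨mem_univ _, hv⟩

/-- The derived trace of an anchored set has one vertex fewer. -/
theorem card_derS {K : Finset (Fin (n + 2))} (ha : aA n ∈ K) : #(derS n K) = #K - 1 := by
  rw [← card_map Fin.castSuccEmb, map_derS, card_erase_of_mem ha]

open Classical in
/-- On an anchored positive the gate sees exactly the clique vector of the derived `(k-1)`-set. -/
theorem dval_eq_cliqueVec {K : Finset (Fin (n + 2))} (ha : aA n ∈ K) (hb : bB n ∈ K) :
    (fun j => decide (EvalDNF (dd n j) (cliqueVec K))) =
      fun j => cliqueVec (derS n K) ((eqv (n + 1)).symm j) := by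
  funext j
  obtain ⟨α, β, -, hp⟩ := exists_eq_pair n (pr n j)
  have hp' : (((eqv (n + 1)).symm j : EP (n + 1)) : Sym2 (Fin (n + 1))) = s(α, β) := hp
  have lhs : EvalDNF (dd n j) (cliqueVec K) ↔ (Fin.castSucc α ∈ K ∧ Fin.castSucc β ∈ K) := by
    rw [evalDNF_dd_iff]
    simp only [cliqueVec, e0_coe, embE_coe, hp, Sym2.map_mk, decide_eq_true_eq, Sym2.mem_iff,
      forall_eq_or_imp, forall_eq]
    exact ⟨fun h => h.2, fun h => ⟨⟨ha, hb⟩, h⟩⟩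
  have rhs : cliqueVec (derS n K) ((eqv (n + 1)).symm j) = true ↔
      (Fin.castSucc α ∈ K ∧ Fin.castSucc β ∈ K) := by
    simp only [cliqueVec, hp', decide_eq_true_eq, Sym2.mem_iff, forall_eq_or_imp, forall_eq, derS,
      mem_filter, mem_univ, true_and]
  rw [Bool.eq_iff_iff, decide_eq_true_eq, lhs, rhs]

/-! ### Values on the anchored negatives -/

/-- Helper lemma (see the module docstring). -/
theorem mem_clause_iff {h : ℕ} (hh : 2 * h ≤ n) (p : EP (n + 1)) {γ : ℕ} (hγ : γ < h) (e : EV n) :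
    e ∈ clause n p γ ↔ e = e0 n ∨ ∃ α ∈ verts n p, e = fE n α γ := by
  have hγn : γ + 1 ≤ n := by omega
  rw [clause, mem_filter, clauseS, mem_insert, mem_image]
  simp only [mem_univ, true_and]
  constructor
  · rintro (h1 | ⟨α, hα, h2⟩)
    · left
      exact Subtype.ext h1
    · right
      refine ⟨α, hα, Subtype.ext ?_⟩
      rw [fE_coe n α hγn]
      exact h2.symm
  · rintro (rfl | ⟨α, hα, rfl⟩)
    · left; rfl
    · right
      exact ⟨α, hα, (fE_coe n α hγn).symm⟩

open Classical in
/-- On an anchored negative (`e₀ ∈ M`) the `j`-th negative child is OFF iff some class `γ < h` has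
both class edges of the pair inside `M`. -/
theorem cval_false_iff {h : ℕ} (hh : 2 * h ≤ n) {M : Finset (EV n)} (he : e0 n ∈ M)
    (j : Fin (nP (n + 1))) :
    decide (EvalCNF (cc n h j) (fun e => decide (e ∉ M))) = false ↔
      ∃ γ, γ < h ∧ ∀ α ∈ verts n (pr n j), fE n α γ ∈ M := by
  rw [decide_eq_false_iff_not]
  constructor
  · intro hnot
    by_contra hno
    apply hnot
    intro S hS
    obtain ⟨γ, hγ, rfl⟩ := mem_image.1 hS
    rw [mem_range] at hγ
    by_contra hsat
    apply hno
    refine ⟨γ, hγ, fun α hα => ?_⟩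
    by_contra hαM
    refine hsat ⟨fE n α γ, (mem_clause_iff n hh _ hγ _).2 (Or.inr ⟨α, hα, rfl⟩), ?_⟩
    exact decide_eq_true hαM
  · rintro ⟨γ, hγ, hall⟩ hcnf
    obtain ⟨e, he', hx⟩ := hcnf (clause n (pr n j) γ) (mem_image.2 ⟨γ, mem_range.2 hγ, rfl⟩)
    have hx' : e ∉ M := of_decide_eq_true hx
    rcases (mem_clause_iff n hh _ hγ e).1 he' with rfl | ⟨α, hα, rfl⟩
    · exact hx' he
    · exact hx' (hall α hα)

/-- The colouring of the derived vertices read off an anchored negative all of whose vertices carry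
a class: `col α = min {γ < h : f(α,γ) ∈ M}`. -/
def col (n h : ℕ) (M : Finset (EV n)) (hM : ∀ α : Fin (n + 1), ∃ γ, γ < h ∧ fE n α γ ∈ M)
    (α : Fin (n + 1)) : Fin h :=
  ⟨Nat.find (hM α), (Nat.find_spec (hM α)).1⟩

/-- Helper lemma (see the module docstring). -/
theorem col_spec (h : ℕ) (M : Finset (EV n)) (hM : ∀ α : Fin (n + 1), ∃ γ, γ < h ∧ fE n α γ ∈ M)
    (α : Fin (n + 1)) : fE n α (col n h M hM α).1 ∈ M :=
  (Nat.find_spec (hM α)).2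

open Classical in
/-- On a fully classified anchored negative the gate sees a vector BELOW the colouring vector of `col`. -/
theorem cval_le_colorVec {h : ℕ} (hh : 2 * h ≤ n) {M : Finset (EV n)} (he : e0 n ∈ M)
    (hM : ∀ α : Fin (n + 1), ∃ γ, γ < h ∧ fE n α γ ∈ M) :
    (fun j => decide (EvalCNF (cc n h j) (fun e => decide (e ∉ M)))) ≤
      fun j => colorVec (col n h M hM) ((eqv (n + 1)).symm j) := by
  intro j
  show decide (EvalCNF (cc n h j) fun e => decide (e ∉ M)) ≤ colorVec (col n h M hM) ((eqv (n + 1)).symm j)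
  cases hc : decide (EvalCNF (cc n h j) fun e => decide (e ∉ M)) with
  | false => exact Bool.false_le _
  | true =>
    by_contra hlt
    have h2 : colorVec (col n h M hM) ((eqv (n + 1)).symm j) = false := by
      revert hlt
      cases colorVec (col n h M hM) ((eqv (n + 1)).symm j) <;> simp
    obtain ⟨α, β, -, hp⟩ := exists_eq_pair n (pr n j)
    have hp' : (((eqv (n + 1)).symm j : EP (n + 1)) : Sym2 (Fin (n + 1))) = s(α, β) := hp
    have hcol : col n h M hM α = col n h M hM β := by
      simpa [colorVec, hp', Sym2.map_mk] using h2
    have h3 : decide (EvalCNF (cc n h j) (fun e => decide (e ∉ M))) = false := by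
      rw [cval_false_iff n hh he]
      refine ⟨(col n h M hM α).1, (col n h M hM α).2, fun v hv => ?_⟩
      rw [verts_pair n hp, mem_insert, mem_singleton] at hv
      rcases hv with rfl | rfl
      · exact col_spec n h M hM _
      · rw [hcol]
        exact col_spec n h M hM _
    rw [hc] at h3
    exact Bool.noConfusion h3

end Children

end

end Summit.PneNP.PneNP.Theorems.CliqueExtLowerBound.Negative
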